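import Mathlib.Data.Real.Basic
import Mathlib.Tactic.Linarith
import Mathlib.Tactic.Ring
import Mathlib.Tactic.Positivity
import Mathlib.Tactic.LinearCombination
import HarnessLib

/-!
# Two-cuts with the root and one target on the root side (MODE B), IX: the near lemma — from the τ-rows to the θ-rows

Support file for the Sahi programme (`--supports stmt-CriticalPhenomena-4575`, prover prim-sahi-p2 gen 26).  No definitions, no named
facts, no sorries; standard axioms.  Memo `run/shared/lean/prim/prim-sahi/FROM-prim-sahi-p2-gen26-NEAR-LEMMA.md` §1 ((R1)).

The A-part real core `IncStarTwoCut.twoCut_Apart_nonneg` is fed with the pseudo-law `u′ = u_A − θ_x u_x − θ_y u_y` of gen 25 ((B1)), while parts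
IV–VIII prove the cone rows for `u″ = u_A − τ_x u_x − τ_y u_y` with the larger coefficients `τ ≥ θ ≥ 0` (`near_theta_le_tau`).  Since every row
`L` is linear and nonnegative at the port vectors `u_x = (0, qX, 0, w)`, `u_y = (0, 0, qY, w)`, the rows transfer:
`L(u′) = L(u″) + (τ_x − θ_x)·L(u_x) + (τ_y − θ_y)·L(u_y) ≥ 0`.  This file is that bookkeeping (`near_theta_rows`), with the eight conclusions
in the letter of the hypotheses `haX haY haXY hpUα hHx hHy hHu hHw` of `twoCut_Apart_nonneg` for the vector
`(aX − θx·qX, aY − θy·qY, aXY − (θx+θy)·w)` with mass `α − θx·x̄ − θy·ȳ`.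
-/

namespace Summit.CriticalPhenomena.PercolationContinuityZ3.Theorems

namespace IncStarTwoCut

/-- **From the τ-rows to the θ-rows.**  Class law `(q₀, qX, qY, w)` with `x̄ = qX + w`, `ȳ = qY + w`, elementary constraints
`0 ≤ qX, qY, w`, `x̄, ȳ ≤ 1`, `x̄ + ȳ − w ≤ 1`, `x̄ȳ ≤ w`; a class vector `(a₀, aX, aY, aXY)` of `A` with `a₀ ≥ 0`; coefficients
`θx ≤ τx`, `θy ≤ τy`.  If the eight cone rows hold for `u″ = u_A − τx·u_x − τy·u_y` then they hold for `u′ = u_A − θx·u_x − θy·u_y`.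
[this work] -/
theorem near_theta_rows {qX qY w a0 aX aY aXY τx τy θx θy : ℝ}
    (hqX : 0 ≤ qX) (hqY : 0 ≤ qY) (hw : 0 ≤ w) (hxb1 : qX + w ≤ 1) (hyb1 : qY + w ≤ 1) (hub1 : qX + qY + w ≤ 1)
    (hc : (qX + w) * (qY + w) ≤ w) (ha0 : 0 ≤ a0)
    (hθτx : θx ≤ τx) (hθτy : θy ≤ τy)
    -- the rows for u″
    (pX : 0 ≤ aX - τx * qX) (pY : 0 ≤ aY - τy * qY) (pXY : 0 ≤ aXY - (τx + τy) * w)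
    (rHx : (qX + w) * (a0 + aX + aY + aXY - τx * (qX + w) - τy * (qY + w)) ≤ (aX - τx * qX) + (aXY - (τx + τy) * w))
    (rHy : (qY + w) * (a0 + aX + aY + aXY - τx * (qX + w) - τy * (qY + w)) ≤ (aY - τy * qY) + (aXY - (τx + τy) * w))
    (rHu : (qX + qY + w) * (a0 + aX + aY + aXY - τx * (qX + w) - τy * (qY + w))
        ≤ (aX - τx * qX) + (aY - τy * qY) + (aXY - (τx + τy) * w))
    (rHw : w * (a0 + aX + aY + aXY - τx * (qX + w) - τy * (qY + w)) ≤ aXY - (τx + τy) * w) :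
    -- the rows for u′, in the format of `twoCut_Apart_nonneg` (aX′ aY′ aXY′ ; α′)
    (0 ≤ aX - θx * qX) ∧ (0 ≤ aY - θy * qY) ∧ (0 ≤ aXY - (θx + θy) * w) ∧
    ((aX - θx * qX) + (aY - θy * qY) + (aXY - (θx + θy) * w) ≤ a0 + aX + aY + aXY - θx * (qX + w) - θy * (qY + w)) ∧
    ((qX + w) * (a0 + aX + aY + aXY - θx * (qX + w) - θy * (qY + w)) ≤ (aX - θx * qX) + (aXY - (θx + θy) * w)) ∧
    ((qY + w) * (a0 + aX + aY + aXY - θx * (qX + w) - θy * (qY + w)) ≤ (aY - θy * qY) + (aXY - (θx + θy) * w)) ∧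
    ((qX + w + (qY + w) - w) * (a0 + aX + aY + aXY - θx * (qX + w) - θy * (qY + w))
        ≤ (aX - θx * qX) + (aY - θy * qY) + (aXY - (θx + θy) * w)) ∧
    (w * (a0 + aX + aY + aXY - θx * (qX + w) - θy * (qY + w)) ≤ aXY - (θx + θy) * w) := by
  have dx : 0 ≤ τx - θx := by linarith
  have dy : 0 ≤ τy - θy := by linarith
  -- nonnegativity of the rows at the port vectors u_x = (0,qX,0,w), u_y = (0,0,qY,w)
  have ex1 : 0 ≤ (τx - θx) * qX := mul_nonneg dx hqX
  have ey1 : 0 ≤ (τy - θy) * qY := mul_nonneg dy hqY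
  have exw : 0 ≤ (τx - θx) * w := mul_nonneg dx hw
  have eyw : 0 ≤ (τy - θy) * w := mul_nonneg dy hw
  -- Harris rows at u_x: X̂: x̄ − x̄² ; Ŷ: w − ȳx̄ ; Û: x̄(1 − ū) ; Ŵ: w(1 − x̄)  (all ≥ 0), and symmetrically at u_y
  have hxX : 0 ≤ (τx - θx) * ((qX + w) * (1 - (qX + w))) := mul_nonneg dx (mul_nonneg (by linarith) (by linarith))
  have hxY : 0 ≤ (τx - θx) * (w - (qY + w) * (qX + w)) := mul_nonneg dx (by nlinarith)
  have hxU : 0 ≤ (τx - θx) * ((qX + w) * (1 - (qX + qY + w))) := mul_nonneg dx (mul_nonneg (by linarith) (by linarith))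
  have hxW : 0 ≤ (τx - θx) * (w * (1 - (qX + w))) := mul_nonneg dx (mul_nonneg hw (by linarith))
  have hyY : 0 ≤ (τy - θy) * ((qY + w) * (1 - (qY + w))) := mul_nonneg dy (mul_nonneg (by linarith) (by linarith))
  have hyX : 0 ≤ (τy - θy) * (w - (qX + w) * (qY + w)) := mul_nonneg dy (by nlinarith)
  have hyU : 0 ≤ (τy - θy) * ((qY + w) * (1 - (qX + qY + w))) := mul_nonneg dy (mul_nonneg (by linarith) (by linarith))
  have hyW : 0 ≤ (τy - θy) * (w * (1 - (qY + w))) := mul_nonneg dy (mul_nonneg hw (by linarith))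
  refine ⟨by linarith, by linarith, by linarith, by linarith, ?_, ?_, ?_, ?_⟩
  · linear_combination rHx + hxX + hyX
  · linear_combination rHy + hyY + hxY
  · linear_combination rHu + hxU + hyU
  · linear_combination rHw + hxW + hyW

end IncStarTwoCut

end Summit.CriticalPhenomena.PercolationContinuityZ3.Theorems
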